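import Summits.Ventures.QEC.Census.CertBZInfoSets
import Summits.Ventures.QEC.Census.BB.BB144.BZAut4Data
import HarnessLib

/-!
# `BB144` — `bz` certificate, side Z: relative-rank BOUNDS per block, tier KERNEL (item S7.BZI; qec-search-7)

For each block `b`: `cert.bzZBound bzAut4Data b = true` by `decide +kernel` — the Brouwer–Zimmermann bound
`Σ_i (t_i + 1 − (k_b − relRank_i))`, with the relative ranks RECOUNTED from the information-set masks
(`bzBoundList`), reaches `wEff + 1` (CERT-FORMAT C3 / C17 (6); the `hbound` input of `BZAssembly.forall_lt_of_bz`).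
-/

namespace Summit.Ventures.QEC.Census.BB144

/-- Block 0: bound 11 ≥ target (kernel). -/
theorem aut4BoundZ_0 : BB144.cert.bzZBound BB144.bzAut4Data 0 = true := by decide +kernel

/-- Block 1: bound 11 ≥ target (kernel). -/
theorem aut4BoundZ_1 : BB144.cert.bzZBound BB144.bzAut4Data 1 = true := by decide +kernel

/-- Block 2: bound 11 ≥ target (kernel). -/
theorem aut4BoundZ_2 : BB144.cert.bzZBound BB144.bzAut4Data 2 = true := by decide +kernel

/-- Block 3: bound 11 ≥ target (kernel). -/
theorem aut4BoundZ_3 : BB144.cert.bzZBound BB144.bzAut4Data 3 = true := by decide +kernel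

end Summit.Ventures.QEC.Census.BB144
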